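import Mathlib
import HarnessLib
import Summits.Ventures.LatticeQCDFlow.Exactness.NCMCGeneralSpaceReweightedCLT

/-!
# The studentized CLT for a self-normalised ratio along an i.i.d. run: the plug-in variance is consistent

HONEST FRAMING: exact (Metropolis-corrected) sampling algorithms for lattice gauge theory;
figures of merit are autocorrelation/cost numbers at stated couplings and volumes; no
continuum-physics claim.

Venture `LatticeQCDFlow` (cell pub-lqcd), topic `Exactness`; FANOUT row 13 (`eng-snf`, GEN-14).
NEW WORK of the cell (elementary asymptotic statistics on product laws: the strong law, Slutsky's
theorem and one implication of the portmanteau theorem, all from Mathlib), not a published result;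
nothing is cited as a fact (the "delta method" / "sandwich" variance of a ratio estimator named only).
Continuation of `NCMCGeneralSpaceReweightedCLT.lean` (GEN-12: the ratio delta method
`√n (A_n/B_n − α/β) →d N(0, Var_μ[a − (α/β) b]/β²)`), which says what the asymptotic variance of a
self-normalised ratio IS; this file says that the natural PLUG-IN (residual) variance estimates it
consistently, so the studentized pivot is asymptotically standard normal.  The Crooks-pair reading
(reweighted end-point observables, the engine's `estimators.reweight` error bar) is the companion
file `NCMCGeneralSpaceReweightedStudentizedCLT.lean`.

## Setting and content

`μ` a probability law on records `E`, runs `ω : ℕ → E` under `Measure.infinitePi (fun _ => μ)`;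
measurable `a, b ∈ L²(μ)` with `b > 0`, means `α, β`, `r = α/β`, partial sums `A_n, B_n`,
`r̂_n = A_n/B_n`, residual sum of squares `S_n = Σ_{i<n} (a(ω i) − r̂_n b(ω i))²`, and
`σ² = Var_μ[a − r b] = E_μ(a − r b)²`.

* `sum_sq_sub_mul`, `integral_sq_sub_mul`, `measurable_sum_range`, `sqrt_mul_mul_div_sqrt_eq` —
  bookkeeping; **`tendsto_residualMeanSquare_ae`** — STRONG CONSISTENCY OF THE PLUG-IN VARIANCE:
  `S_n/n → σ²` a.s. (expand the square, three strong laws, `r̂_n → r`);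
  `tendsto_studentizingFactor_ae` — `(B_n/n)/√(S_n/n) → β/σ` a.s. (`σ² > 0`).
* **`tendstoInDistribution_studentized_ratio`** — THE STUDENTIZED CLT FOR A SELF-NORMALISED RATIO:
  `(r̂_n − r) · B_n / √S_n →d N(0, 1)` (GEN-12's ratio CLT with limit `(σ/β) Z`, times the
  a.s.-convergent factor; Slutsky; the `√n`'s cancel); **`tendsto_measure_abs_studentized_ratio_le`**
  — COVERAGE: `μ^{⊗ℕ}{|(r̂_n − r) B_n/√S_n| ≤ z} → gaussianReal 0 1 [−z, z]` (portmanteau).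
  Equivalently: with `V̂_n = n S_n/B_n²` the plug-in ("sandwich") variance, `√n (r̂_n − r)/√V̂_n →d N(0,1)`.

Scope / NOT CLAIMED: i.i.d. runs only; asymptotic statements only — no finite-`n` guarantee and no
rate; the degenerate case `σ² = 0` is excluded.
-/

namespace Summit.Ventures.LatticeQCDFlow.Exactness.GeneralNCMC

open MeasureTheory ProbabilityTheory Set Filter Finset
open scoped ENNReal NNReal Topology

variable {E : Type*} [MeasurableSpace E]

/-! ## Bookkeeping -/

/-- `Σ (u_i − ρ v_i)² = Σ u_i² − 2ρ Σ u_i v_i + ρ² Σ v_i²`. -/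
theorem sum_sq_sub_mul (s : Finset ℕ) (u v : ℕ → ℝ) (ρ : ℝ) :
    ∑ i ∈ s, (u i - ρ * v i) ^ 2 =
      ∑ i ∈ s, u i ^ 2 - 2 * ρ * ∑ i ∈ s, u i * v i + ρ ^ 2 * ∑ i ∈ s, v i ^ 2 := by
  simp only [Finset.mul_sum, ← Finset.sum_sub_distrib, ← Finset.sum_add_distrib]
  exact Finset.sum_congr rfl fun i _ => by ring

/-- `(√n · d) · ((B/n)/√(S/n)) = d · B/√S` whenever `B = 0` for `n = 0` (the `√n`'s cancel). -/
theorem sqrt_mul_mul_div_sqrt_eq (n : ℕ) {B : ℝ} (d S : ℝ) (hB : n = 0 → B = 0) :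
    √(n : ℝ) * d * (B / n / √(S / n)) = d * B / √S := by
  rcases Nat.eq_zero_or_pos n with rfl | hn
  · simp [hB rfl]
  · have hn' : (0 : ℝ) < n := by exact_mod_cast hn
    rw [Real.sqrt_div' S hn'.le, div_div_eq_mul_div]
    have hid : √(n : ℝ) * d * (B / n * √(n : ℝ) / √S) = d * B / √S * (√(n : ℝ) * √(n : ℝ) / n) := by
      ring
    rw [hid, Real.mul_self_sqrt hn'.le, div_self hn'.ne', mul_one]

/-- A finite sum of a measurable function over coordinates of a run is measurable. -/
theorem measurable_sum_range {g : E → ℝ} (hg : Measurable g) (n : ℕ) :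
    Measurable fun ω : ℕ → E => ∑ i ∈ range n, g (ω i) :=
  Finset.measurable_sum _ fun i _ => hg.comp (measurable_pi_apply i)

section IID

variable (μ : Measure E) [IsProbabilityMeasure μ]
variable {Ω' : Type*} [MeasurableSpace Ω'] {P' : Measure Ω'} [IsProbabilityMeasure P']

omit [IsProbabilityMeasure μ] in
/-- `E_μ(a − ρ b)² = E a² − 2ρ E(ab) + ρ² E b²` for `a, b ∈ L²(μ)`. -/
theorem integral_sq_sub_mul {a b : E → ℝ} (ha2 : MemLp a 2 μ) (hb2 : MemLp b 2 μ) (ρ : ℝ) :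
    ∫ x, (a x - ρ * b x) ^ 2 ∂μ =
      ∫ x, a x ^ 2 ∂μ - 2 * ρ * ∫ x, a x * b x ∂μ + ρ ^ 2 * ∫ x, b x ^ 2 ∂μ := by
  have hab : Integrable (fun x => a x * b x) μ := ha2.integrable_mul hb2
  have h1 : Integrable (fun x => a x ^ 2) μ := ha2.integrable_sq
  have h2 : Integrable (fun x => b x ^ 2) μ := hb2.integrable_sq
  have hpt : ∀ x, (a x - ρ * b x) ^ 2 = a x ^ 2 - 2 * ρ * (a x * b x) + ρ ^ 2 * b x ^ 2 :=
    fun x => by ring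
  simp_rw [hpt]
  have e1 : ∫ x, (a x ^ 2 - 2 * ρ * (a x * b x) + ρ ^ 2 * b x ^ 2) ∂μ =
      ∫ x, (a x ^ 2 - 2 * ρ * (a x * b x)) ∂μ + ∫ x, ρ ^ 2 * b x ^ 2 ∂μ :=
    integral_add (h1.sub (hab.const_mul _)) (h2.const_mul _)
  have e2 : ∫ x, (a x ^ 2 - 2 * ρ * (a x * b x)) ∂μ = ∫ x, a x ^ 2 ∂μ - ∫ x, 2 * ρ * (a x * b x) ∂μ :=
    integral_sub h1 (hab.const_mul _)
  rw [e1, e2, integral_const_mul, integral_const_mul]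

/-! ## Strong consistency of the plug-in variance of a self-normalised ratio -/

/-- **Strong consistency of the residual mean square.**  For measurable `a, b ∈ L²(μ)` with `b > 0`,
means `α, β` and `r = α/β`, along almost every infinite i.i.d. run
`(1/n) Σ_{i<n} (a(ω i) − r̂_n b(ω i))² → Var_μ[a − r b]`, `r̂_n = Σ_{i<n} a(ω i)/Σ_{i<n} b(ω i)`
(expand the square; the strong law for `a², ab, b²`; `r̂_n → r`). -/
theorem tendsto_residualMeanSquare_ae {a b : E → ℝ} (ham : Measurable a) (hbm : Measurable b)
    (hbpos : ∀ x, 0 < b x) (ha2 : MemLp a 2 μ) (hb2 : MemLp b 2 μ) :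
    ∀ᵐ ω ∂(Measure.infinitePi fun _ : ℕ => μ),
      Tendsto (fun n : ℕ => (∑ i ∈ range n, (a (ω i) -
          (∑ j ∈ range n, a (ω j)) / (∑ j ∈ range n, b (ω j)) * b (ω i)) ^ 2) / n) atTop
        (𝓝 (Var[fun x => a x - (∫ x, a x ∂μ) / (∫ x, b x ∂μ) * b x; μ])) := by
  set α := ∫ x, a x ∂μ with hαdef
  set β := ∫ x, b x ∂μ with hβdef
  have hbi : Integrable b μ := hb2.integrable one_le_two
  have hβ : 0 < β := by
    rw [hβdef, integral_pos_iff_support_of_nonneg (fun x => (hbpos x).le) hbi]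
    have hsupp : Function.support b = univ := by
      ext x
      simp only [Function.mem_support, mem_univ, iff_true]
      exact (hbpos x).ne'
    rw [hsupp, measure_univ]
    exact one_pos
  set r := α / β with hrdef
  have hab : Integrable (fun x => a x * b x) μ := ha2.integrable_mul hb2
  -- the limit is `E a² − 2 r E(ab) + r² E b²`
  have hd2 : MemLp (fun x => a x - r * b x) 2 μ := ha2.sub (hb2.const_mul r)
  have hdmean : ∫ x, (a x - r * b x) ∂μ = 0 := by
    rw [integral_sub (ha2.integrable one_le_two) (hbi.const_mul r), integral_const_mul, ← hαdef,
      ← hβdef, hrdef, div_mul_cancel₀ _ hβ.ne', sub_self]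
  have hvar : Var[fun x => a x - r * b x; μ] =
      ∫ x, a x ^ 2 ∂μ - 2 * r * ∫ x, a x * b x ∂μ + r ^ 2 * ∫ x, b x ^ 2 ∂μ := by
    rw [variance_of_integral_eq_zero (X := fun x => a x - r * b x)
      (ham.sub (hbm.const_mul r)).aemeasurable hdmean, integral_sq_sub_mul μ ha2 hb2 r]
  have h1 := tendsto_sampleMean_ae μ ham (ha2.integrable one_le_two)
  have h2 := tendsto_sampleMean_ae μ hbm hbi
  have h3 := tendsto_sampleMean_ae μ (ham.pow_const 2) ha2.integrable_sq
  have h4 := tendsto_sampleMean_ae μ (hbm.pow_const 2) hb2.integrable_sq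
  have h5 := tendsto_sampleMean_ae μ (g := fun x => a x * b x) (ham.mul hbm) hab
  filter_upwards [h1, h2, h3, h4, h5] with ω hω1 hω2 hω3 hω4 hω5
  -- `r̂_n → r`
  have hr : Tendsto (fun n : ℕ => (∑ j ∈ range n, a (ω j)) / ∑ j ∈ range n, b (ω j)) atTop (𝓝 r) := by
    refine (hω1.div hω2 hβ.ne').congr' ?_
    filter_upwards [eventually_gt_atTop 0] with n hn
    have hn' : (n : ℝ) ≠ 0 := by exact_mod_cast hn.ne'
    simp only [Pi.div_apply, sampleMean]
    rw [Fin.sum_univ_eq_sum_range (fun i => a (ω i)) n, Fin.sum_univ_eq_sum_range (fun i => b (ω i)) n,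
      div_div_div_cancel_right₀ hn']
  have key := (hω3.sub ((tendsto_const_nhds (x := (2 : ℝ))).mul hr |>.mul hω5)).add ((hr.pow 2).mul hω4)
  rw [hvar]
  refine key.congr fun n => ?_
  simp only [sampleMean]
  rw [Fin.sum_univ_eq_sum_range (fun i => a (ω i) ^ 2) n, Fin.sum_univ_eq_sum_range (fun i => b (ω i) ^ 2) n,
    Fin.sum_univ_eq_sum_range (fun i => a (ω i) * b (ω i)) n, sum_sq_sub_mul]
  ring

/-- **The studentizing factor converges a.s.**: with `S_n` the residual sum of squares and
`σ² = Var_μ[a − r b] > 0`, `(B_n/n)/√(S_n/n) → β/√σ²` along almost every run. -/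
theorem tendsto_studentizingFactor_ae {a b : E → ℝ} (ham : Measurable a) (hbm : Measurable b)
    (hbpos : ∀ x, 0 < b x) (ha2 : MemLp a 2 μ) (hb2 : MemLp b 2 μ)
    (hσ : 0 < Var[fun x => a x - (∫ x, a x ∂μ) / (∫ x, b x ∂μ) * b x; μ]) :
    ∀ᵐ ω ∂(Measure.infinitePi fun _ : ℕ => μ),
      Tendsto (fun n : ℕ => (∑ i ∈ range n, b (ω i)) / n /
          √((∑ i ∈ range n, (a (ω i) -
            (∑ j ∈ range n, a (ω j)) / (∑ j ∈ range n, b (ω j)) * b (ω i)) ^ 2) / n)) atTop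
        (𝓝 ((∫ x, b x ∂μ) / √(Var[fun x => a x - (∫ x, a x ∂μ) / (∫ x, b x ∂μ) * b x; μ]))) := by
  filter_upwards [tendsto_sampleMean_ae μ hbm (hb2.integrable one_le_two),
    tendsto_residualMeanSquare_ae μ ham hbm hbpos ha2 hb2] with ω hω2 hωS
  have hB : Tendsto (fun n : ℕ => (∑ i ∈ range n, b (ω i)) / n) atTop (𝓝 (∫ x, b x ∂μ)) :=
    hω2.congr fun n => by
      simp only [sampleMean]
      rw [Fin.sum_univ_eq_sum_range (fun i => b (ω i)) n]
  exact hB.div hωS.sqrt (Real.sqrt_pos.2 hσ).ne'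

/-! ## The studentized CLT for a self-normalised ratio -/

/-- **Studentized CLT for a self-normalised ratio.**  For measurable `a, b ∈ L²(μ)` with `b > 0`,
`r = E a/E b` and `Var_μ[a − r b] > 0`, along an infinite i.i.d. run
`(r̂_n − r) · B_n / √S_n →d N(0, 1)`, where `r̂_n = A_n/B_n` and `S_n = Σ_{i<n} (a(ω i) − r̂_n b(ω i))²`
(GEN-12's `√n (r̂_n − r) →d N(0, σ²/β²)` times `(B_n/n)/√(S_n/n) → β/σ`; Slutsky). -/
theorem tendstoInDistribution_studentized_ratio {a b : E → ℝ} (ham : Measurable a)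
    (hbm : Measurable b) (hbpos : ∀ x, 0 < b x) (ha2 : MemLp a 2 μ) (hb2 : MemLp b 2 μ)
    (hσ : 0 < Var[fun x => a x - (∫ x, a x ∂μ) / (∫ x, b x ∂μ) * b x; μ]) {Z : Ω' → ℝ}
    (hZ : HasLaw Z (gaussianReal 0 1) P') :
    TendstoInDistribution
      (fun (n : ℕ) (ω : ℕ → E) =>
        ((∑ i ∈ range n, a (ω i)) / (∑ i ∈ range n, b (ω i)) - (∫ x, a x ∂μ) / (∫ x, b x ∂μ)) *
          (∑ i ∈ range n, b (ω i)) /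
          √(∑ i ∈ range n, (a (ω i) -
            (∑ j ∈ range n, a (ω j)) / (∑ j ∈ range n, b (ω j)) * b (ω i)) ^ 2))
      atTop Z (fun _ => Measure.infinitePi fun _ : ℕ => μ) P' := by
  set P := Measure.infinitePi fun _ : ℕ => μ with hP
  set α := ∫ x, a x ∂μ with hαdef
  set β := ∫ x, b x ∂μ with hβdef
  have hbi : Integrable b μ := hb2.integrable one_le_two
  have hβ : 0 < β := by
    rw [hβdef, integral_pos_iff_support_of_nonneg (fun x => (hbpos x).le) hbi]
    have hsupp : Function.support b = univ := by
      ext x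
      simp only [Function.mem_support, mem_univ, iff_true]
      exact (hbpos x).ne'
    rw [hsupp, measure_univ]
    exact one_pos
  set r := α / β with hrdef
  set σ2 := Var[fun x => a x - r * b x; μ] with hσ2def
  set v := σ2 / β ^ 2 with hvdef
  have hv : 0 < v := div_pos hσ (pow_pos hβ 2)
  have hsσ : √σ2 ≠ 0 := (Real.sqrt_pos.2 hσ).ne'
  have hsv : √v = √σ2 / β := by
    rw [hvdef, Real.sqrt_div' σ2 (pow_nonneg hβ.le 2), Real.sqrt_sq hβ.le]
  -- `Y = √v · Z ~ N(0, v)`: GEN-12's ratio CLT applies with this limit variable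
  have hY : HasLaw (fun ω' => √v * Z ω') (gaussianReal 0 (σ2 / β ^ 2).toNNReal) P' := by
    have h := gaussianReal_const_mul hZ (√v)
    rw [mul_zero, mul_one] at h
    convert h using 3
    apply NNReal.eq
    rw [Real.coe_toNNReal _ hv.le, NNReal.coe_mk, Real.sq_sqrt hv.le]
  have clt := tendstoInDistribution_sqrt_mul_ratio_sub μ ham hbm hbpos ha2 hb2 hY
  -- the studentizing factor converges in probability to `β/√σ2`
  have hUmeas : ∀ n : ℕ, AEMeasurable (fun ω : ℕ → E => (∑ i ∈ range n, b (ω i)) / n /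
      √((∑ i ∈ range n, (a (ω i) -
        (∑ j ∈ range n, a (ω j)) / (∑ j ∈ range n, b (ω j)) * b (ω i)) ^ 2) / n)) P := by
    intro n
    have hA := measurable_sum_range ham n
    have hB := measurable_sum_range hbm n
    have hS : Measurable fun ω : ℕ → E => ∑ i ∈ range n, (a (ω i) -
        (∑ j ∈ range n, a (ω j)) / (∑ j ∈ range n, b (ω j)) * b (ω i)) ^ 2 :=
      Finset.measurable_sum _ fun i _ => ((ham.comp (measurable_pi_apply i)).sub
        ((hA.div hB).mul (hbm.comp (measurable_pi_apply i)))).pow_const 2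
    exact ((hB.div_const _).div (hS.div_const _).sqrt).aemeasurable
  have hU : TendstoInMeasure P (fun (n : ℕ) (ω : ℕ → E) => (∑ i ∈ range n, b (ω i)) / n /
      √((∑ i ∈ range n, (a (ω i) -
        (∑ j ∈ range n, a (ω j)) / (∑ j ∈ range n, b (ω j)) * b (ω i)) ^ 2) / n))
      atTop (fun _ => β / √σ2) :=
    tendstoInMeasure_of_tendsto_ae (fun n => (hUmeas n).aestronglyMeasurable)
      (tendsto_studentizingFactor_ae μ ham hbm hbpos ha2 hb2 hσ)
  have slutsky := clt.continuous_comp_prodMk_of_tendstoInMeasure_const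
    (g := fun p : ℝ × ℝ => p.1 * p.2) (by fun_prop) hU hUmeas
  refine slutsky.congr (fun n => Eventually.of_forall fun ω => ?_)
    (Eventually.of_forall fun ω' => ?_)
  · show √(n : ℝ) * ((∑ i ∈ range n, a (ω i)) / (∑ i ∈ range n, b (ω i)) - α / β) *
        ((∑ i ∈ range n, b (ω i)) / n /
          √((∑ i ∈ range n, (a (ω i) -
            (∑ j ∈ range n, a (ω j)) / (∑ j ∈ range n, b (ω j)) * b (ω i)) ^ 2) / n)) = _
    exact sqrt_mul_mul_div_sqrt_eq n _ _ fun hn => by rw [hn, Finset.range_zero, Finset.sum_empty]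
  · show √v * Z ω' * (β / √σ2) = Z ω'
    rw [hsv]
    field_simp

/-- **Coverage of the studentized interval for a ratio.**  For `z ≥ 0`,
`μ^{⊗ℕ} {|(r̂_n − r) B_n/√S_n| ≤ z} → gaussianReal 0 1 [−z, z]` (portmanteau: the Gaussian puts no
mass on the two-point frontier). -/
theorem tendsto_measure_abs_studentized_ratio_le {a b : E → ℝ} (ham : Measurable a)
    (hbm : Measurable b) (hbpos : ∀ x, 0 < b x) (ha2 : MemLp a 2 μ) (hb2 : MemLp b 2 μ)
    (hσ : 0 < Var[fun x => a x - (∫ x, a x ∂μ) / (∫ x, b x ∂μ) * b x; μ]) {z : ℝ} (hz : 0 ≤ z) :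
    Tendsto (fun n : ℕ => (Measure.infinitePi fun _ : ℕ => μ)
        {ω | |((∑ i ∈ range n, a (ω i)) / (∑ i ∈ range n, b (ω i)) - (∫ x, a x ∂μ) / (∫ x, b x ∂μ)) *
          (∑ i ∈ range n, b (ω i)) /
          √(∑ i ∈ range n, (a (ω i) -
            (∑ j ∈ range n, a (ω j)) / (∑ j ∈ range n, b (ω j)) * b (ω i)) ^ 2)| ≤ z})
      atTop (𝓝 (gaussianReal 0 1 (Icc (-z) z))) := by
  have h := tendstoInDistribution_studentized_ratio μ ham hbm hbpos ha2 hb2 hσ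
    (P' := gaussianReal 0 1) (Z := id) HasLaw.id
  have hnull : ((gaussianReal 0 1).map id) (frontier (Icc (-z) z)) = 0 := by
    rw [Measure.map_id, frontier_Icc (by linarith : -z ≤ z)]
    haveI := nullSingletonClass_gaussianReal (μ := 0) (v := 1) one_ne_zero
    exact (Set.toFinite {-z, z}).measure_zero _
  have key := ProbabilityMeasure.tendsto_measure_of_null_frontier_of_tendsto' h.tendsto
    (E := Icc (-z) z) (by simpa using hnull)
  simp only [ProbabilityMeasure.coe_mk, Measure.map_id] at key
  refine key.congr fun n => ?_
  rw [Measure.map_apply_of_aemeasurable (h.forall_aemeasurable n) measurableSet_Icc]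
  congr 1
  ext ω
  simp only [Set.mem_preimage, Set.mem_Icc, mem_setOf_eq, abs_le]

end IID

end Summit.Ventures.LatticeQCDFlow.Exactness.GeneralNCMC
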